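import Literature.MathematicalPhysics.QuantumFieldTheory.Balaban1983to89.B13DomainKernelWalks

/-!
# Spine/NE5/TwoRunPencilDomains — row NE5's two-run pencil at the level of NODE O's BASE OBJECTS: two domain-localised one-step
# operator data on a SHARED skeleton (the located typing point (x4) answered: «the shared skeleton IS the record minus `op`»)
# give a pencil of domain-localised data with the letter `λ` inflated by `(1 + τr)` (cell `pub-balaban-gaps`, seat `ne5` gen 6)

WHY (`HOME/ne/NE5.md` §11 (x4), §12 standing offer (s6-c)).  (x4) recorded that NE5's two-run comparison needs the two runs' walk
data on a SHARED skeleton with termwise closeness — not expressible from two ∃-packaged `TermWalkData` facts — and asked the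
builder for a Type-valued walk-data record.  g1-p2's `B13DomainKernelWalks.DomainTerms` (p357908 ✓) IS such a record at the level
print works at ([B9] (3.107)–(3.108): finitely many domain-localised operator terms `b ↦ (dom b, anchor b, J b, op b)`), and
`DomainTerms.IsDomainLocal` + `jointWalkExpansion_domainLocal` turn it into the NODE-O object with torus-free letters.  THIS FILE:
* `withOp L op′` — run A's datum with its COEFFICIENTS replaced, skeleton `(B, dom, anchor, J)` kept (the only new `def`; data);
  run B of the pair is `withOp L opB` for coefficients `opB` indexed by run A's terms — the shared skeleton made literal;
* `kernel_withOp_pencil` — the kernel is LINEAR in the coefficients: the pencil datum `withOp L (op_A + t(op_B − op_A))` has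
  kernel `K_A + t(K_B − K_A)` (the object T8∕T10∕T12 take as input);
* `isDomainLocal_withOp_pencil` — if run A's datum is `IsDomainLocal` with letters `(R, λ, r, m_J, n_D)`, run B's coefficients are
  supported in the same domains, holomorphic on the same ball and `‖op_B b u i j − op_A b u i j‖ ≤ r_AB·λ` (the two-run rate at
  the LOCAL level — row NE2's deliverable for the local cube factors, `ne/NE5.md` (r4″)), then for `‖t‖ ≤ τ` the pencil datum is
  `IsDomainLocal` with `λ(1 + τr_AB)` and EVERY OTHER LETTER UNCHANGED — so `jointWalkExpansion_domainLocal` applies to every pencil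
  member with one package (`isDomainLocal_withOp_pencil_reach`: `τ = s∕r_AB`, letters free of the rate).
HONEST FRAMING.  Bookkeeping (linearity + triangle inequality) over g1-p2's landed record and hypothesis shape; the two runs'
coefficients, their closeness and every letter are HYPOTHESES; nothing of Bałaban's `h_□G′_□h_□`, `K(h_□)G′_□h_□` is constructed;
NE5 NOT PRINTED ∕ NOT PROVED; (D4) 0∕1; 0∕12 NE5 leaves; words UNCHANGED.  Rung (B)+1 on a FIXED finite T⁴ — NOT continuum, NOT
infinite volume, NOT mass gap, NOT Clay.  Spine PROVED 0∕9.  1 data `def`, 0 sorry.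
Sources: [B9] = T. Bałaban, CMP **99** (1985) [Balaban1985BackgroundPropagators] Thm 3.10 (3.107)–(3.108) p. 416; [II] = CMP **116** (1988)
[Balaban1988RG2Cluster] (1.5) p. 3, (1.11) p. 5, p. 13, p. 15.  Nothing here is a claim about the mass gap.
-/

noncomputable section

namespace Summit.QuantumFields.BalabanUV.T4Continuum.Spine.NE5.TwoRunPencilDomains

open Metric Set Finset
open Literature.MathematicalPhysics.QuantumFieldTheory.Balaban1983to89
open Literature.MathematicalPhysics.QuantumFieldTheory.Balaban1983to89.TreeLengthTorus (TPt)
open Literature.MathematicalPhysics.QuantumFieldTheory.Balaban1983to89.B5TorusCover (UT)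
open Literature.MathematicalPhysics.QuantumFieldTheory.Balaban1983to89.B13DomainKernelWalks (DomainTerms)

variable {d N' : ℕ} {ν : ℕ} {Nf : Fin ν → ℕ} [∀ i, NeZero (Nf i)]
variable {p n : Type}
variable {E : Type*} [NormedAddCommGroup E] [NormedSpace ℂ E]

/-- **Run A's datum with its coefficients replaced** (skeleton `(B, dom, anchor, J)` kept): the shared-skeleton format of
(x4) — run B of a pair is `withOp L opB`, a pencil member is `withOp L (op_A + t(op_B − op_A))`. [cite: Balaban1985BackgroundPropagators, (3.107) p.416] -/
def withOp (L : DomainTerms d N' ν Nf p n E) (op' : L.B → E → Matrix p n ℂ) : DomainTerms d N' ν Nf p n E :=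
  { L with op := op' }

variable (L : DomainTerms d N' ν Nf p n E)

/-- The replaced datum has the same terms index, domains, anchors and parameter sets; its coefficient is `op′`. [folklore] -/
theorem withOp_op (op' : L.B → E → Matrix p n ℂ) : (withOp L op').op = op' := rfl

/-- Entry formula of the replaced datum's terms. [cite: Balaban1988RG2Cluster, (1.11) p.5] -/
theorem term_withOp_apply (op' : L.B → E → Matrix p n ℂ) (b : L.B) (σ : TPt d N' → ℂ) (u : E) (i : p) (j : n) :
    (withOp L op').term b σ u i j = (∏ j ∈ L.J b, σ j) * op' b u i j :=
  (withOp L op').term_apply b σ u i j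

/-- **The kernel is linear in the coefficients**: the pencil datum's kernel is the pencil of the kernels,
`K_t = K_A + t(K_B − K_A)` with `K_B` the kernel of `withOp L opB`. [cite: Balaban1985BackgroundPropagators, (3.107) p.416] -/
theorem kernel_withOp_pencil (opB : L.B → E → Matrix p n ℂ) (t : ℂ) (σ : TPt d N' → ℂ) (u : E) :
    (withOp L fun b u => L.op b u + t • (opB b u - L.op b u)).kernel σ u =
      L.kernel σ u + t • ((withOp L opB).kernel σ u - L.kernel σ u) := by
  show (∑ b : L.B, (∏ j ∈ L.J b, σ j) • (L.op b u + t • (opB b u - L.op b u))) =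
    (∑ b : L.B, (∏ j ∈ L.J b, σ j) • L.op b u) +
      t • ((∑ b : L.B, (∏ j ∈ L.J b, σ j) • opB b u) - ∑ b : L.B, (∏ j ∈ L.J b, σ j) • L.op b u)
  rw [← Finset.sum_sub_distrib, Finset.smul_sum, ← Finset.sum_add_distrib]
  refine Finset.sum_congr rfl fun b _ => ?_
  ext i j
  simp only [Matrix.add_apply, Matrix.smul_apply, Matrix.sub_apply, smul_eq_mul]
  ring

variable {L}
variable {c : B13.Consts} {locp : p → UT Nf} {locn : n → UT Nf} {X : Finset (UT Nf)} {R lam r : ℝ} {mJ nD : ℕ}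

/-- **THE PENCIL OF DOMAIN-LOCALISED DATA IS DOMAIN-LOCALISED, `λ ↦ λ(1 + τ r_AB)`.**  Run A's datum `IsDomainLocal` with letters
`(R, λ, r, m_J, n_D)`; run B's coefficients `opB` (on run A's term index — the shared skeleton) supported in the same domains,
entrywise holomorphic on the `R`-ball, and close to run A's at the LOCAL two-run rate, `‖opB b u i j − op b u i j‖ ≤ r_AB·λ`; then
for every `t ∈ ℂ`, `‖t‖ ≤ τ`, the pencil datum `withOp L (op + t(opB − op))` is `IsDomainLocal` with `λ(1 + τr_AB)`, every other
letter unchanged — hence (g1-p2 `jointWalkExpansion_domainLocal`) a `JointWalkExpansion` with ONE package along the pencil.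
[cite: Balaban1985BackgroundPropagators, Thm 3.10 (3.107)–(3.108) p.416; Balaban1988RG2Cluster, (1.5) p.3, (1.11) p.5, p.15] -/
theorem isDomainLocal_withOp_pencil (hL : L.IsDomainLocal c locp locn X R lam r mJ nD)
    {opB : L.B → E → Matrix p n ℂ}
    (hsuppB : ∀ b u i j, opB b u i j ≠ 0 → locp i ∈ L.dom b ∧ locn j ∈ L.dom b)
    (hanB : ∀ b i j, DifferentiableOn ℂ (fun u => opB b u i j) (ball (0 : E) R))
    {rAB τ : ℝ} (hτ : 0 ≤ τ)
    (hdiff : ∀ b, ∀ u ∈ ball (0 : E) R, ∀ i j, ‖opB b u i j - L.op b u i j‖ ≤ rAB * lam)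
    {t : ℂ} (ht : ‖t‖ ≤ τ) :
    (withOp L fun b u => L.op b u + t • (opB b u - L.op b u)).IsDomainLocal c locp locn X R ((1 + τ * rAB) * lam) r mJ nD where
  hanchor := hL.hanchor
  hsupp b u i j hne := by
    -- a nonzero pencil entry has a nonzero entry of run A or of run B
    by_cases hA : L.op b u i j = 0
    · refine hsuppB b u i j fun hB => hne ?_
      show (L.op b u + t • (opB b u - L.op b u)) i j = 0
      simp [Matrix.add_apply, Matrix.smul_apply, Matrix.sub_apply, hA, hB]
    · exact hL.hsupp b u i j hA
  han b i j := by
    show DifferentiableOn ℂ (fun u => (L.op b u + t • (opB b u - L.op b u)) i j) (ball (0 : E) R)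
    simp only [Matrix.add_apply, Matrix.smul_apply, Matrix.sub_apply, smul_eq_mul]
    exact (hL.han b i j).add (((hanB b i j).sub (hL.han b i j)).const_mul t)
  hbd b u hu i j := by
    show ‖(L.op b u + t • (opB b u - L.op b u)) i j‖ ≤ (1 + τ * rAB) * lam
    simp only [Matrix.add_apply, Matrix.smul_apply, Matrix.sub_apply, smul_eq_mul]
    calc ‖L.op b u i j + t * (opB b u i j - L.op b u i j)‖
        ≤ ‖L.op b u i j‖ + ‖t‖ * ‖opB b u i j - L.op b u i j‖ := (norm_add_le _ _).trans (by rw [norm_mul])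
      _ ≤ lam + τ * (rAB * lam) := by
          gcongr
          · exact hL.hbd b u hu i j
          · exact hdiff b u hu i j
      _ = (1 + τ * rAB) * lam := by ring
  hdiam := hL.hdiam
  hJ := hL.hJ
  hX := hL.hX
  hmult := hL.hmult

/-- **Reach form** (`τ = s∕r_AB`): on the disc `‖t‖ ≤ s∕r_AB` the letter is `λ(1 + s)` — independent of the rate (NE5's FIXED
reach while `r_AB = r_j → 0`). [cite: Balaban1988RG2Cluster, (1.5) p.3, (2.16) p.16; Balaban1985BackgroundPropagators, Thm 3.10 p.416] -/
theorem isDomainLocal_withOp_pencil_reach (hL : L.IsDomainLocal c locp locn X R lam r mJ nD)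
    {opB : L.B → E → Matrix p n ℂ}
    (hsuppB : ∀ b u i j, opB b u i j ≠ 0 → locp i ∈ L.dom b ∧ locn j ∈ L.dom b)
    (hanB : ∀ b i j, DifferentiableOn ℂ (fun u => opB b u i j) (ball (0 : E) R))
    {rAB s : ℝ} (hr : 0 < rAB) (hs : 0 ≤ s)
    (hdiff : ∀ b, ∀ u ∈ ball (0 : E) R, ∀ i j, ‖opB b u i j - L.op b u i j‖ ≤ rAB * lam)
    {t : ℂ} (ht : ‖t‖ ≤ s / rAB) :
    (withOp L fun b u => L.op b u + t • (opB b u - L.op b u)).IsDomainLocal c locp locn X R ((1 + s) * lam) r mJ nD := by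
  have hsr : 1 + s / rAB * rAB = 1 + s := by rw [div_mul_cancel₀ s hr.ne']
  simpa only [hsr] using isDomainLocal_withOp_pencil hL hsuppB hanB (div_nonneg hs hr.le) hdiff ht

/-- **Run B itself** (`t = 1`, `τ = 1`): the shared-skeleton datum `withOp L opB` is `IsDomainLocal` with `λ(1 + r_AB)` (and
with `2λ` when `r_AB ≤ 1`). [cite: Balaban1985BackgroundPropagators, Thm 3.10 p.416] -/
theorem isDomainLocal_withOp_runB (hL : L.IsDomainLocal c locp locn X R lam r mJ nD)
    {opB : L.B → E → Matrix p n ℂ}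
    (hsuppB : ∀ b u i j, opB b u i j ≠ 0 → locp i ∈ L.dom b ∧ locn j ∈ L.dom b)
    (hanB : ∀ b i j, DifferentiableOn ℂ (fun u => opB b u i j) (ball (0 : E) R))
    {rAB : ℝ}
    (hdiff : ∀ b, ∀ u ∈ ball (0 : E) R, ∀ i j, ‖opB b u i j - L.op b u i j‖ ≤ rAB * lam) :
    (withOp L opB).IsDomainLocal c locp locn X R ((1 + 1 * rAB) * lam) r mJ nD := by
  have h := isDomainLocal_withOp_pencil hL hsuppB hanB zero_le_one hdiff (t := 1) (by simp)
  have e : (withOp L fun b u => L.op b u + (1 : ℂ) • (opB b u - L.op b u)) = withOp L opB := by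
    simp only [one_smul, add_sub_cancel]
  rw [e] at h
  exact h

end Summit.QuantumFields.BalabanUV.T4Continuum.Spine.NE5.TwoRunPencilDomains

end
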